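import Summits.Ventures.PercRepro.Night2LocalD3TwoTwoC

/-!
# PercRepro — the cell `(a, k) = (2, 2)` at `|E ∖ G| = 3`, `q = 4`: **`load2_le_cap2_two_two`** (night-2, gen 13)

The assembly of `Night2LocalD3TwoTwoA/B/C.lean` (`proofs/NIGHT-2-dq3.md` §5.3): at a far set `S` with two coloops
(`coloops S = K`), `cap₂(S) ≥ 2/5`, and

* without a fat pair member every loss is `≤ req/3 ≤ 1/15`, every `w₂ ≤ 1/15`, `#ex2 ≤ 6`: `load₂ ≤ 2/5`;
* with a fat pair member `F`: `w₂(F) ≤ 2 · (6/25)(3/8) = 18/100`; every other member `B = S ∖ {z, z'}` has exactly one of `z, z'`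
  in `F` (both: `B` is no member; neither: `B = F`), loses nothing at the covering set `S ∖ (the one in F)` and at most
  `(1/5)(3/8)` at the other: `w₂(B) ≤ 3/80`; so `load₂ ≤ 18/100 + 5 · 3/80 = 147/400 ≤ 2/5`.
-/

open scoped Matroid

namespace PercRepro.Shadow

open Finset PerFlat ThmH

variable {α : Type*} [DecidableEq α] {M : Matroid α} [M.Finite]

section TwoTwoD

variable {G S : Finset α}

open scoped Classical in
/-- The loss of a member `B = S ∖ {z, z'}` at `B ∪ {z} = S ∖ z'`, from a bound on `L₁(S ∖ z')`. -/
theorem loss_le_of_L1_erase_le (hd : (gr M \ G).card = 3) (hk : kColoops M G = 2) (hSG : S ⊆ G) {B : Finset α}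
    (hBS : B ⊆ S) {z z' : α} (hP : S \ B = {z, z'}) (hzz' : z ≠ z') {L : ℚ} (hL : L1 M 4 G (S.erase z') ≤ L) :
    loss M 4 G B z ≤ req M 4 B * (if L ≤ 2 / 5 then (0 : ℚ) else (L - 2 / 5) / L) := by
  rw [erase_eq_insert_of_sdiff_pair hBS hP hzz'] at hL
  exact loss_le_req_mul_lossFrac hL (two_fifths_le_capS hd hk ((Finset.insert_subset_iff.2
    ⟨hSG (Finset.mem_sdiff.1 (by rw [hP]; exact Finset.mem_insert_self z {z'} : z ∈ S \ B)).1, hBS.trans hSG⟩)))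

open scoped Classical in
/-- **THE CELL `(a, k) = (2, 2)` AT `|E ∖ G| = 3`, `q = 4`**: every far set with two coloops satisfies `load₂(S) ≤ cap₂(S)`. -/
theorem load2_le_cap2_two_two (hs : ∀ e ∈ gr M, ∀ f ∈ gr M, e ≠ f → rkN M {e, f} = 2) (hl : ∀ e ∈ gr M, M.Indep {e})
    (hG : G ∈ flatsQ M (4 + 1)) (hd : (gr M \ G).card = 3) (hk : kColoops M G = 2)
    (hS : S ∈ shadowAt M (4 + 2) 4 (Uq M (4 + 2) 4) G) (ha : (coloops M S).card = 2) :
    load2 M 4 G S ≤ cap2 M 4 G S := by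
  set K := G.filter (fun y => y ∉ clF M (G.erase y)) with hKdef
  have hcol : coloops M S = K := coloops_eq_filter_of_card hS (by rw [ha, hk])
  have hcap2 : 2 / 5 ≤ cap2 M 4 G S := two_fifths_le_cap2_of_coloops_eq_K hG hd hk hS hcol
  have hcap0 : ∀ S', 0 ≤ capS M 4 G S' := capS_nonneg' hG (by omega)
  by_cases hex : ex2 M 4 G S = ∅
  · have hzero : load2 M 4 G S = 0 := by
      unfold load2
      apply Finset.sum_eq_zero
      intro B hB
      by_contra hne
      have hmem : B ∈ ex2 M 4 G S := by unfold ex2; exact Finset.mem_filter.2 ⟨hB, hne⟩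
      rw [hex] at hmem
      exact Finset.notMem_empty _ hmem
    rw [hzero]
    exact cap2_nonneg (hcap0 S)
  obtain ⟨B₀, hB₀⟩ := Finset.nonempty_iff_ne_empty.2 hex
  have hS6 : S.card = 6 := card_eq_six_of_mem_ex2' hs hl hG hd hk hB₀
  have hSG : S ⊆ G := subset_of_mem_shadowAt hS
  have hKS : K ⊆ S := hcol ▸ coloops_subset_self S
  have hex6 : (ex2 M 4 G S).card ≤ 6 := by
    have := two_mul_card_ex2_le hG hS
    rw [ha] at this
    omega
  -- the pair structure of a member carrying weight
  have hpair : ∀ B ∈ ex2 M 4 G S, B ∈ membersIn M (Uq M (4 + 2) 4) G ∧ K ⊆ B ∧ B ⊆ S ∧ (S \ B).card = 2 ∧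
      S \ B ⊆ G \ clF M B ∧ B ∉ lay0 M 4 G := by
    intro B hB
    obtain ⟨hBm, hB0, hBS, hsub, hcard⟩ := mem_ex2_unpack hB
    exact ⟨hBm, fun e he => mem_of_mem_ex2_of_mem_coloops hG hS hB (hcol ▸ he), hBS, hcard, hsub, hB0⟩
  have hmemK : ∀ z ∈ S, z ∉ K → z ∈ S \ K := fun z hz hzK => Finset.mem_sdiff.2 ⟨hz, hzK⟩
  -- the two covering sets of a member are shadow sets
  have hcov : ∀ B ∈ ex2 M 4 G S, ∀ z z', S \ B = {z, z'} → z ≠ z' →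
      S.erase z' ∈ shadowAt M (4 + 2) 4 (Uq M (4 + 2) 4) G ∧ z' ∈ S \ K := by
    intro B hB z z' hP hzz'
    refine ⟨erase_mem_shadowAt_of_pair hG hB hP hzz', ?_⟩
    have hz' : z' ∈ S \ B := by rw [hP]; exact Finset.mem_insert_of_mem (Finset.mem_singleton_self _)
    exact hmemK z' (Finset.mem_sdiff.1 hz').1 (fun h => (Finset.mem_sdiff.1 hz').2 ((hpair B hB).2.1 h))
  have hw2 : ∀ B ∈ ex2 M 4 G S, ∀ z z', S \ B = {z, z'} → z ≠ z' →
      w2 M 4 G B S = (loss M 4 G B z + loss M 4 G B z') / (((G \ clF M B).card : ℚ) - 1) := by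
    intro B hB z z' hP hzz'
    obtain ⟨-, -, hBS, hcard, hsub, hB0⟩ := hpair B hB
    unfold w2
    rw [if_pos ⟨hB0, hBS, hsub, hcard⟩, hP, Finset.sum_pair hzz']
  by_cases hfat : ∃ F ∈ membersIn M (Uq M (4 + 2) 4) G, K ⊆ F ∧ F ⊆ S ∧ (S \ F).card = 2 ∧ G \ S ⊆ clF M F
  · -- a fat pair member `F`
    obtain ⟨F, hF, hKF, hFS, hFc, hfatF⟩ := hfat
    have hreqF : req M 4 F ≤ 6 / 25 := (req_pair_le hG hd hS hS6 hcol hF hKF hFS hFc).1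
    have hfrac16 : (if (16 / 25 : ℚ) ≤ 2 / 5 then (0 : ℚ) else (16 / 25 - 2 / 5) / (16 / 25)) = 3 / 8 := by norm_num
    have hfrac2 : (if (2 / 5 : ℚ) ≤ 2 / 5 then (0 : ℚ) else (2 / 5 - 2 / 5) / (2 / 5)) = 0 := by norm_num
    -- the losses at `S ∖ v`: `≤ req · 3/8` always, `0` for `v ∈ F`
    have hloss : ∀ B ∈ ex2 M 4 G S, ∀ z z', S \ B = {z, z'} → z ≠ z' →
        loss M 4 G B z ≤ req M 4 B * (3 / 8) ∧ (z' ∈ F → loss M 4 G B z = 0) := by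
      intro B hB z z' hP hzz'
      obtain ⟨hSv, hv⟩ := hcov B hB z z' hP hzz'
      have hBS := (hpair B hB).2.2.1
      constructor
      · have h := loss_le_of_L1_erase_le hd hk hSG hBS hP hzz'
          (L1_erase_le_of_fat hs hG hd hk hS hS6 hcol hF hKF hFS hFc hfatF hv hSv)
        rwa [hfrac16] at h
      · intro hz'F
        have h := loss_le_of_L1_erase_le hd hk hSG hBS hP hzz'
          (L1_erase_le_of_mem_fat hs hG hd hk hS hS6 hcol hF hKF hFS hFc hfatF hz'F hv hSv)
        rw [hfrac2, mul_zero] at h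
        exact le_antisymm h (loss_nonneg (hcap0 _))
    have hw : ∀ B ∈ ex2 M 4 G S, w2 M 4 G B S ≤ 3 / 80 + (if B = F then 18 / 100 - 3 / 80 else 0) := by
      intro B hB
      obtain ⟨hBm, hKB, hBS, hcard, hsub, hB0⟩ := hpair B hB
      obtain ⟨z, z', hzz', hP⟩ := Finset.card_eq_two.1 hcard
      have hP' : S \ B = {z', z} := by rw [hP, Finset.pair_comm]
      rw [hw2 B hB z z' hP hzz']
      have hm2 : 2 ≤ (G \ clF M B).card := hcard ▸ Finset.card_le_card hsub
      have hden1 : (1 : ℚ) ≤ ((G \ clF M B).card : ℚ) - 1 := by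
        have : (2 : ℚ) ≤ ((G \ clF M B).card : ℚ) := by exact_mod_cast hm2
        linarith
      by_cases hBF : B = F
      · rw [if_pos hBF]
        have h1 := (hloss B hB z z' hP hzz').1
        have h2 := (hloss B hB z' z hP' hzz'.symm).1
        rw [hBF] at h1 h2
        rw [hBF]
        calc (loss M 4 G F z + loss M 4 G F z') / (((G \ clF M F).card : ℚ) - 1)
            ≤ (loss M 4 G F z + loss M 4 G F z') / 1 := by
              apply div_le_div_of_nonneg_left _ one_pos (hBF ▸ hden1)
              exact add_nonneg (loss_nonneg (hcap0 _)) (loss_nonneg (hcap0 _))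
          _ ≤ (6 / 25 * (3 / 8) + 6 / 25 * (3 / 8)) / 1 := by
              apply div_le_div_of_nonneg_right _ one_pos.le
              have h3 : req M 4 F * (3 / 8) ≤ 6 / 25 * (3 / 8) := by nlinarith
              linarith
          _ = 3 / 80 + (18 / 100 - 3 / 80) := by norm_num
      · rw [if_neg hBF, add_zero]
        -- `B` is not fat: `req B ≤ 1/5`, `|G ∖ cl B| ≥ 3`
        have hnotfat : ¬ (G \ S ⊆ clF M B) := fun h =>
          not_two_fat_pairs hs hG hd hk hS hS6 hcol hBm hF hKB hKF hBS hFS hcard hFc hBF h hfatF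
        have hreqB : req M 4 B ≤ 1 / 5 := (req_pair_le hG hd hS hS6 hcol hBm hKB hBS hcard).2.1 hnotfat
        have hm3 : 3 ≤ (G \ clF M B).card := (req_pair_le hG hd hS hS6 hcol hBm hKB hBS hcard).2.2.2 hnotfat
        have hden2 : (2 : ℚ) ≤ ((G \ clF M B).card : ℚ) - 1 := by
          have : (3 : ℚ) ≤ ((G \ clF M B).card : ℚ) := by exact_mod_cast hm3
          linarith
        have hz : z ∈ S \ B := by rw [hP]; exact Finset.mem_insert_self _ _
        have hz' : z' ∈ S \ B := by rw [hP]; exact Finset.mem_insert_of_mem (Finset.mem_singleton_self _)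
        -- exactly one of `z, z'` lies in `F`
        have hone : (z ∈ F ∧ z' ∉ F) ∨ (z ∉ F ∧ z' ∈ F) := by
          by_cases hzF : z ∈ F <;> by_cases hz'F : z' ∈ F
          · -- both: `B` is no member
            exfalso
            apply not_mem_Uq_of_sdiff_subset_clF hG hd hk hF hKF hKB _ (mem_membersIn.1 hBm).1
            intro e he
            rw [Finset.mem_sdiff] at he
            by_cases heS : e ∈ S
            · have : e ∈ S \ B := Finset.mem_sdiff.2 ⟨heS, he.2⟩
              rw [hP, Finset.mem_insert, Finset.mem_singleton] at this
              have hFcl : F ⊆ clF M F := subset_clF (mem_membersIn.1 hF).1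
              rcases this with rfl | rfl
              · exact hFcl hzF
              · exact hFcl hz'F
            · exact hfatF (Finset.mem_sdiff.2 ⟨he.1, heS⟩)
          · exact Or.inl ⟨hzF, hz'F⟩
          · exact Or.inr ⟨hzF, hz'F⟩
          · -- neither: `S ∖ B = S ∖ F`, so `B = F`
            exfalso
            apply hBF
            have hPF : S \ B = S \ F := by
              apply Finset.eq_of_subset_of_card_le
              · intro e he
                rw [Finset.mem_sdiff]
                refine ⟨(Finset.mem_sdiff.1 he).1, ?_⟩
                rw [hP, Finset.mem_insert, Finset.mem_singleton] at he
                rcases he with rfl | rfl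
                · exact hzF
                · exact hz'F
              · omega
            calc B = S \ (S \ B) := (Finset.sdiff_sdiff_eq_self hBS).symm
              _ = S \ (S \ F) := by rw [hPF]
              _ = F := Finset.sdiff_sdiff_eq_self hFS
        have hnum : loss M 4 G B z + loss M 4 G B z' ≤ 3 / 40 := by
          rcases hone with ⟨hzF, hz'F⟩ | ⟨hzF, hz'F⟩
          · -- `z ∈ F`: the loss at `S ∖ z` (the covering set of `z'`) vanishes
            have h0 := (hloss B hB z' z hP' hzz'.symm).2 hzF
            have h1 := (hloss B hB z z' hP hzz').1
            have : req M 4 B * (3 / 8) ≤ 1 / 5 * (3 / 8) := by nlinarith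
            linarith
          · have h0 := (hloss B hB z z' hP hzz').2 hz'F
            have h1 := (hloss B hB z' z hP' hzz'.symm).1
            have : req M 4 B * (3 / 8) ≤ 1 / 5 * (3 / 8) := by nlinarith
            linarith
        calc (loss M 4 G B z + loss M 4 G B z') / (((G \ clF M B).card : ℚ) - 1)
            ≤ (3 / 40) / 2 := div_le_div₀ (by norm_num) hnum (by norm_num) hden2
          _ = 3 / 80 := by norm_num
    -- sum up
    have hload : load2 M 4 G S ≤ ∑ B ∈ ex2 M 4 G S, (3 / 80 + (if B = F then (18 / 100 - 3 / 80 : ℚ) else 0)) := by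
      unfold load2
      rw [← Finset.sum_filter_ne_zero]
      exact Finset.sum_le_sum (fun B hB => hw B hB)
    rw [Finset.sum_add_distrib, Finset.sum_const, Finset.sum_ite, Finset.sum_const_zero, add_zero,
      Finset.sum_const, nsmul_eq_mul, nsmul_eq_mul] at hload
    have h1 : ((ex2 M 4 G S).filter (fun B => B = F)).card ≤ 1 := by
      rw [Finset.card_le_one]
      intro a ha b hb
      rw [Finset.mem_filter] at ha hb
      rw [ha.2, hb.2]
    have h1' : (((ex2 M 4 G S).filter (fun B => B = F)).card : ℚ) ≤ 1 := by exact_mod_cast h1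
    have h6 : ((ex2 M 4 G S).card : ℚ) ≤ 6 := by exact_mod_cast hex6
    have h0 : (0 : ℚ) ≤ (((ex2 M 4 G S).filter (fun B => B = F)).card : ℚ) := by positivity
    calc load2 M 4 G S ≤ _ := hload
      _ ≤ 2 / 5 := by nlinarith
      _ ≤ cap2 M 4 G S := hcap2
  · -- no fat pair member
    push Not at hfat
    have hfrac : (if (3 / 5 : ℚ) ≤ 2 / 5 then (0 : ℚ) else (3 / 5 - 2 / 5) / (3 / 5)) = 1 / 3 := by norm_num
    have hw : ∀ B ∈ ex2 M 4 G S, w2 M 4 G B S ≤ 1 / 15 := by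
      intro B hB
      obtain ⟨hBm, hKB, hBS, hcard, hsub, hB0⟩ := hpair B hB
      obtain ⟨z, z', hzz', hP⟩ := Finset.card_eq_two.1 hcard
      have hP' : S \ B = {z', z} := by rw [hP, Finset.pair_comm]
      rw [hw2 B hB z z' hP hzz']
      have hnotfat : ¬ (G \ S ⊆ clF M B) := hfat B hBm hKB hBS hcard
      have hreqB : req M 4 B ≤ 1 / 5 := (req_pair_le hG hd hS hS6 hcol hBm hKB hBS hcard).2.1 hnotfat
      have hm3 : 3 ≤ (G \ clF M B).card := (req_pair_le hG hd hS hS6 hcol hBm hKB hBS hcard).2.2.2 hnotfat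
      have hden2 : (2 : ℚ) ≤ ((G \ clF M B).card : ℚ) - 1 := by
        have : (3 : ℚ) ≤ ((G \ clF M B).card : ℚ) := by exact_mod_cast hm3
        linarith
      obtain ⟨hSv, hv⟩ := hcov B hB z z' hP hzz'
      obtain ⟨hSv', hv'⟩ := hcov B hB z' z hP' hzz'.symm
      have hl1 := loss_le_of_L1_erase_le hd hk hSG hBS hP hzz'
        (L1_erase_le_of_no_fat hG hd hk hS hS6 hcol hfat hv hSv)
      have hl2 := loss_le_of_L1_erase_le hd hk hSG hBS hP' hzz'.symm
        (L1_erase_le_of_no_fat hG hd hk hS hS6 hcol hfat hv' hSv')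
      rw [hfrac] at hl1 hl2
      have hnum : loss M 4 G B z + loss M 4 G B z' ≤ 2 / 15 := by
        have : req M 4 B * (1 / 3) ≤ 1 / 5 * (1 / 3) := by nlinarith
        linarith
      calc (loss M 4 G B z + loss M 4 G B z') / (((G \ clF M B).card : ℚ) - 1)
          ≤ (2 / 15) / 2 := div_le_div₀ (by norm_num) hnum (by norm_num) hden2
        _ = 1 / 15 := by norm_num
    have hload := load2_le_card_ex2_mul (M := M) (q := 4) (G := G) (S := S) hw
    have h6 : ((ex2 M 4 G S).card : ℚ) ≤ 6 := by exact_mod_cast hex6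
    calc load2 M 4 G S ≤ _ := hload
      _ ≤ 6 * (1 / 15) := by nlinarith
      _ ≤ 2 / 5 := by norm_num
      _ ≤ cap2 M 4 G S := hcap2

end TwoTwoD

end PercRepro.Shadow
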